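import Mathlib.NumberTheory.Padics.PadicNumbers
import Mathlib.RingTheory.AdjoinRoot
import Mathlib.Algebra.Polynomial.Derivative
import Literature.NumberTheory.QuadraticForms.HilbertSymbol
import HarnessLib
import HarnessLib.Audit

/-!
# Green–Maistret's local error term as a symbol in the cubic algebra (-es g21, §30.13; E29-R2)

For a local field `𝒦` of characteristic `0` and a separable monic cubic `f = X³ + aX² + bX + c`,
`c ≠ 0`, Green–Maistret (Proc. R. Soc. A 478 (2022), arXiv:2110.06718, Def. 2.8 / Thm. 2.11) define
`𝔈 := (b,−c)(−2L,Δ_f)(L,−b)` (`L = ab − 9c`; degenerate branch `(−c,−1)(2c,Δ_f)` when `b = 0` or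
`L = 0`) and prove `w(E/𝒦)·w(Jac E′/𝒦) = λ_{f,𝒦}·𝔈` for `E : y² = f(x)`, `E′ : y² = x f(x)`.
CONJECTURE (GM-H, this seat; engine GM30: 4 131 / 4 131 local instances over `ℚ_p`, `p` odd, all tame
splitting types, `ℚ₂` split, and `ℝ`): `𝔈 = (−1,−1)_𝒦 · (θ, f′(θ))_{𝒦[θ]/(f)}`, the symbol in the cubic
algebra being the product over its factor fields.  Stated below over `ℚ_[p]` in the three splitting
cases, with the tree's elementary Hilbert symbol `Literature.NumberTheory.QuadraticForms.hilbertSymbol`.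
-/

set_option linter.dupNamespace false

namespace Summit.BirchSwinnertonDyer.BirchSwinnertonDyer.Theorems.GreenMaistretErrorTerm

open Polynomial Literature.NumberTheory.QuadraticForms

/-- Discriminant of the monic cubic `X³ + aX² + bX + c`. -/
def cubicDisc {F : Type*} [Field F] (a b c : F) : F :=
  18*a*b*c - 4*a^3*c + a^2*b^2 - 4*b^3 - 27*c^2

open Classical in
/-- Green–Maistret's local error term `𝔈(f, F)` (Def. 2.8) for `f = X³ + aX² + bX + c`. -/
noncomputable def gmErrorTerm (F : Type*) [Field F] (a b c : F) : ℤ :=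
  if b ≠ 0 ∧ a*b - 9*c ≠ 0 then
    hilbertSymbol F b (-c) * hilbertSymbol F (-2*(a*b - 9*c)) (cubicDisc a b c)
      * hilbertSymbol F (a*b - 9*c) (-b)
  else hilbertSymbol F (-c) (-1) * hilbertSymbol F (2*c) (cubicDisc a b c)

/-- GM-H, SPLIT CASE over `ℚ_[p]`: for pairwise distinct non-zero `α₁ α₂ α₃` and
`f = ∏ (X − αᵢ)` (so `a = −S₁`, `b = S₂`, `c = −α₁α₂α₃`), using the Steinberg reduction
`(θ, f′(θ))_A = ∏_{i<j} (αᵢ, αⱼ)`:  `𝔈 = (−1,−1)·(α₁,α₂)(α₁,α₃)(α₂,α₃)`. -/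
@[conjecture] def GreenMaistretSplitLaw : Prop :=
  ∀ (p : ℕ) [Fact p.Prime] (α₁ α₂ α₃ : ℚ_[p]),
    α₁ ≠ 0 → α₂ ≠ 0 → α₃ ≠ 0 → α₁ ≠ α₂ → α₁ ≠ α₃ → α₂ ≠ α₃ →
    gmErrorTerm ℚ_[p] (-(α₁ + α₂ + α₃)) (α₁*α₂ + α₁*α₃ + α₂*α₃) (-(α₁*α₂*α₃))
      = hilbertSymbol ℚ_[p] (-1) (-1)
        * (hilbertSymbol ℚ_[p] α₁ α₂ * hilbertSymbol ℚ_[p] α₁ α₃ * hilbertSymbol ℚ_[p] α₂ α₃)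

/-- GM-H, IRREDUCIBLE CASE over `ℚ_[p]`: `f` monic irreducible cubic with `f(0) ≠ 0`,
`A = ℚ_[p][θ]/(f)` a field: `𝔈 = (−1,−1)_{ℚ_p} · (θ, f′(θ))_A`. -/
@[conjecture] def GreenMaistretIrreducibleLaw : Prop :=
  ∀ (p : ℕ) [Fact p.Prime] (f : Polynomial ℚ_[p]) [Fact (Irreducible f)],
    f.Monic → f.natDegree = 3 → f.coeff 0 ≠ 0 →
    gmErrorTerm ℚ_[p] (f.coeff 2) (f.coeff 1) (f.coeff 0)
      = hilbertSymbol ℚ_[p] (-1) (-1)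
        * hilbertSymbol (AdjoinRoot f) (AdjoinRoot.root f) (AdjoinRoot.mk f (derivative f))

/-- GM-H, ONE-ROOT CASE over `ℚ_[p]`: `f = (X − r)·g` with `g` monic irreducible quadratic,
`r ≠ 0`, `g(0) ≠ 0`, `g(r) ≠ 0`; `A = ℚ_[p] × ℚ_[p][θ]/(g)`:
`𝔈 = (−1,−1) · (r, f′(r))_{ℚ_p} · (θ, f′(θ))_{ℚ_p[θ]/(g)}`. -/
@[conjecture] def GreenMaistretOneRootLaw : Prop :=
  ∀ (p : ℕ) [Fact p.Prime] (r : ℚ_[p]) (g : Polynomial ℚ_[p]) [Fact (Irreducible g)],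
    g.Monic → g.natDegree = 2 → r ≠ 0 → g.coeff 0 ≠ 0 → g.eval r ≠ 0 →
    let f : Polynomial ℚ_[p] := (X - C r) * g
    gmErrorTerm ℚ_[p] (f.coeff 2) (f.coeff 1) (f.coeff 0)
      = hilbertSymbol ℚ_[p] (-1) (-1)
        * (hilbertSymbol ℚ_[p] r ((derivative f).eval r)
           * hilbertSymbol (AdjoinRoot g) (AdjoinRoot.root g) (AdjoinRoot.mk g (derivative f)))

end Summit.BirchSwinnertonDyer.BirchSwinnertonDyer.Theorems.GreenMaistretErrorTerm
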